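import Summits.Ventures.HodgeRepro2.A2PontryaginLefschetz
import Summits.Ventures.HodgeRepro2.A2LiebermanModel

/-!
# The Lieberman class and the Pontryagin class differ as classes (A2 annex, operator identity — part 9)

Row 104 proved that the Weil PROJECTIONS of Theorem A's class `y = z ⋆ θ^k` and of the Lieberman
class `y'' = (L^{n−k})⁻¹ z` of (A9) are proportional; the operator identity of row 109 gives
`y = κ' • Λ^{n−k} z = κ' • Λ^{n−k} L^{n−k} y''`.  The two classes are NOT proportional in general:
`Λ^m L^m` is the scalar `(m!)²` only on primitive classes.  Witness in the three-plane model with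
`θ = E₀ + E₁ + E₂` and `z = θ ∧ E₀ = E₀E₁ + E₀E₂ ∈ ⋀⁴`: the Lieberman class is `y'' = E₀`, the
Pontryagin class is `z ⋆ θ² = 2 vol • (2E₀ + E₁ + E₂)`, and their difference with row 104's
constant `κ = 2 vol` is `2 vol • θ ≠ 0` (`pontryagin_ne_smul_lefschetzInv`).  This is why row 104 is
stated for the Weil projections (the primitive part) and row 109 for the classes.
-/

namespace Summit.Ventures.HodgeRepro2.A2LiebermanClassWitness

open WeilPlanes WeilIntegral WeilCoproduct A2PlaneMonomials A2HardLefschetzOps A2HardLefschetzMain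
  A2PontryaginModel A2PontryaginLefschetz

/-- The three-plane model. -/
abbrev ι₃ : Type := Fin 3

/-- The coefficient vector `(1, 1, 1)`. -/
def c₃ : ι₃ → ℂ := fun _ => 1

/-- Every coefficient is non-zero. -/
lemma c₃_ne_zero : ∀ p, c₃ p ≠ 0 := fun _ => one_ne_zero

/-- `|ι₃| = 3`. -/
lemma card_ι₃ : Fintype.card ι₃ = 3 := Fintype.card_fin 3

/-- `θ = E₀ + E₁ + E₂`. -/
lemma theta_c₃ : theta c₃ = E 0 + E 1 + E 2 := by
  simp [theta, c₃, Fin.sum_univ_three]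

/-- The witness class `z = θ ∧ E₀ ∈ ⋀⁴`. -/
noncomputable def z₃ : A ι₃ := theta c₃ * E 0

/-- `z = E₀E₁ + E₀E₂`. -/
lemma z₃_eq : z₃ = E 0 * E 1 + E 0 * E 2 := by
  rw [z₃, theta_c₃, add_mul, add_mul, E_mul_self, zero_add, (commute_E 1 (E 0)).eq,
    (commute_E 2 (E 0)).eq]

/-- `z ∈ ⋀^{2·3−2} = ⋀⁴`. -/
lemma z₃_mem : z₃ ∈ grading ι₃ (2 * Fintype.card ι₃ - 2) := by
  rw [card_ι₃]
  exact SetLike.mul_mem_graded (theta_mem_two c₃) (E_mem_two 0)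

/-- `2 ≤ |ι₃|`. -/
lemma two_le_card : 2 ≤ Fintype.card ι₃ := by rw [card_ι₃]; norm_num

/-- **The Lieberman class of the witness is `E₀`**: `(L¹)⁻¹ z = E₀`. -/
theorem lefschetzInv_z₃ : lefschetzInv c₃ c₃_ne_zero two_le_card z₃_mem = E 0 := by
  symm
  apply lefschetzInv_unique c₃ c₃_ne_zero two_le_card z₃_mem (E_mem_two 0)
  rw [card_ι₃]
  simp [z₃]

/-- The list of the three planes. -/
def L₃ : List ι₃ := [0, 1, 2]

/-- The three planes are distinct. -/
lemma nodup_L₃ : L₃.Nodup := by decide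

/-- `E₀E₁` as a plane-sorted monomial. -/
lemma E_zero_mul_E_one : E 0 * E 1 = planeProd L₃ ![(true, true), (true, true), (false, false)] := by
  simp [L₃, planeProd]

/-- `E₀E₂` as a plane-sorted monomial. -/
lemma E_zero_mul_E_two : E 0 * E 2 = planeProd L₃ ![(true, true), (false, false), (true, true)] := by
  simp [L₃, planeProd]

/-- `Λ = Λ₀ + Λ₁ + Λ₂` for the coefficients `(1, 1, 1)`. -/
lemma lam_c₃ (x : A ι₃) : lam c₃ x = lamAt 0 x + lamAt 1 x + lamAt 2 x := by
  simp [lam, c₃, Fin.sum_univ_three]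

/-- **`Λ z = 2E₀ + E₁ + E₂`**: the dual Lefschetz class of the witness. -/
theorem lam_z₃ : lam c₃ z₃ = (2 : ℂ) • E 0 + E 1 + E 2 := by
  rw [z₃_eq, map_add, lam_c₃, lam_c₃, E_zero_mul_E_one, E_zero_mul_E_two]
  simp only [lamAt_planeProd nodup_L₃]
  simp [L₃, planeProd, Function.update, two_smul]
  abel

/-- **The Pontryagin class of the witness**: `z ⋆ θ² = 2 vol • (2E₀ + E₁ + E₂)`. -/
theorem pontryagin_z₃ :
    pontryagin z₃ (theta c₃ ^ 2) = ((2 : ℂ) * vol ι₃) • ((2 : ℂ) • E 0 + E 1 + E 2) := by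
  rw [pontryagin_theta_pow_eq_smul_lam_pow c₃_ne_zero two_le_card z₃, kappa', card_ι₃]
  have h1 : (3 - 2 : ℕ) = 1 := rfl
  rw [h1, pow_one, lam_z₃]
  congr 1
  simp [c₃, Nat.factorial]

/-- **The two constructions differ by `2 vol • θ`**: `z ⋆ θ² − κ • y'' = 2 vol • θ` with
`κ = 1!·2!·(∏ c_p)·vol = 2 vol` the constant of row 104. -/
theorem pontryagin_sub_smul_lefschetzInv :
    pontryagin z₃ (theta c₃ ^ 2) -
        ((((Fintype.card ι₃ - 2).factorial : ℂ) * ((2 : ℕ).factorial : ℂ) * ∏ p, c₃ p) * vol ι₃) •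
          lefschetzInv c₃ c₃_ne_zero two_le_card z₃_mem =
      ((2 : ℂ) * vol ι₃) • theta c₃ := by
  rw [pontryagin_z₃, lefschetzInv_z₃, card_ι₃, theta_c₃]
  have h1 : (3 - 2 : ℕ) = 1 := rfl
  rw [h1]
  simp only [Nat.factorial_one, Nat.factorial_two, Nat.cast_one, Nat.cast_ofNat, c₃,
    Finset.prod_const_one, one_mul, mul_one, smul_add, smul_smul]
  module

/-- `θ ≠ 0` in the three-plane model: `∫_B θ ∧ E₁E₂ = vol ≠ 0`. -/
lemma theta_c₃_ne_zero : theta c₃ ≠ 0 := by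
  intro h
  have hET : ET (Finset.univ : Finset ι₃) = E 0 * E 1 * E 2 := by
    rw [ET, Fin.prod_univ_three]
    rfl
  have hint : integral (theta c₃ * (E 1 * E 2)) = vol ι₃ := by
    rw [theta_c₃, add_mul, add_mul, ← mul_assoc (E 1), E_mul_self, zero_mul, add_zero,
      ← mul_assoc (E 2), (commute_E 2 (E 1)).eq, mul_assoc (E 1), E_mul_self, mul_zero, add_zero,
      vol, hET, mul_assoc]
  rw [h, zero_mul, map_zero] at hint
  exact vol_ne_zero ι₃ hint.symm

/-- **The Pontryagin class is not `κ` times the Lieberman class**: the class identity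
`z ⋆ θ^k = (n−k)!·k!·(∏ c_p)·vol • (L^{n−k})⁻¹ z` FAILS (row 104 holds for the Weil projections
only; row 109 is the class identity, with `Λ^{n−k}` in place of `(L^{n−k})⁻¹`). -/
theorem pontryagin_ne_smul_lefschetzInv :
    pontryagin z₃ (theta c₃ ^ 2) ≠
      ((((Fintype.card ι₃ - 2).factorial : ℂ) * ((2 : ℕ).factorial : ℂ) * ∏ p, c₃ p) * vol ι₃) •
        lefschetzInv c₃ c₃_ne_zero two_le_card z₃_mem := by
  intro h
  have h2 := pontryagin_sub_smul_lefschetzInv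
  rw [h, sub_self] at h2
  have : ((2 : ℂ) * vol ι₃) • theta c₃ = 0 := h2.symm
  rcases smul_eq_zero.1 this with h0 | h0
  · exact mul_ne_zero two_ne_zero (vol_ne_zero ι₃) h0
  · exact theta_c₃_ne_zero h0

end Summit.Ventures.HodgeRepro2.A2LiebermanClassWitness
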